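import Mathlib
import Literature.Analysis.Complex.UpperHalfReflection
import HarnessLib

/-!
# Real-line rigidity, step 2: global Schwarz reflection off the corner set
# (crux `BoundaryClosureR`, stmt-CriticalPhenomena-14004, line `polygon-parity-squeeze`,
# sub-goal (A2-main) `realLine_rigidity`, registered helper `realLine_reflection`)

Let `K` be holomorphic on the upper half-plane and `X ⊂ ℝ` finite.  Suppose every real `t ∉ X`
has a disc `B(t, r)` avoiding `X`, a holomorphic `G` on it extending `K` from the upper
half-disc, such that `a G` is a non-negative real on the diameter and the positive measure `ν`
equals `re (a G) dx` on the middle half of the diameter (this is the output of step 1,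
`realLine_localDensity`, applied to the local Schwarz reflections).  Then the boundary-value
extension `F` of `a K` to `U ∩ {im ≥ 0}`, `U = ℂ ∖ X`, is continuous, holomorphic inside and real
on `U ∩ ℝ`, so its Schwarz reflection `K̃` is holomorphic on `U`
(`Complex.differentiableOn_schwarzReflection`); `K̃ = a K` above the axis, `K̃ ∘ conj = conj ∘ K̃`
off the axis, `K̃ ≥ 0` on `U ∩ ℝ`, and `ν = re K̃ dx` on every open subset of `ℝ ∖ X` (the local
identities patched along a countable subcover).  Mathlib and the tree's `upperExt` /
`schwarzReflection` are used; everything is folklore (Conway IX.1.1).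
-/

noncomputable section

open scoped Topology ENNReal ComplexConjugate
open Filter Set MeasureTheory Metric Complex
open Literature.Analysis.Complex (upperExt upperExt_of_im_pos upperExt_eq_of_local)

namespace Summit.CriticalPhenomena.SAWScalingLimit.Theorems.PolygonParitySqueeze

namespace RealLine

/-- **Registered helper `realLine_reflection`** (step (2) of `realLine_rigidity`, line
`polygon-parity-squeeze`): the global Schwarz reflection `K̃` of `a K` across `ℝ ∖ X`, built
from local holomorphic extensions `G` with `a G ≥ 0` on the axis and `ν = re (a G) dx` locally.
`K̃` is holomorphic off the (complexified) finite set `X`, equals `a K` on the upper half-plane,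
commutes with conjugation off the axis, is a non-negative real on `ℝ ∖ X`, and `ν = re K̃ dx` on
every open set of the line avoiding `X`. [folklore] -/
theorem realLine_reflection : ∀ (K : ℂ → ℂ) (X : Finset ℝ) (a : ℂ) (ν : MeasureTheory.Measure ℝ), DifferentiableOn ℂ K {w : ℂ | 0 < w.im} → (∀ t : ℝ, t ∉ X → ∃ r : ℝ, 0 < r ∧ (∀ x ∈ X, r ≤ |t - x|) ∧ ∃ G : ℂ → ℂ, DifferentiableOn ℂ G (Metric.ball (t : ℂ) r) ∧ Set.EqOn G K (Metric.ball (t : ℂ) r ∩ {w : ℂ | 0 < w.im}) ∧ (∀ s ∈ Set.Ioo (t - r) (t + r), (a * G s).im = 0 ∧ 0 ≤ (a * G s).re) ∧ ν.restrict (Set.Ioo (t - r / 2) (t + r / 2)) = (MeasureTheory.volume.withDensity fun s : ℝ => ENNReal.ofReal (a * G s).re).restrict (Set.Ioo (t - r / 2) (t + r / 2))) → ∃ Kt : ℂ → ℂ, DifferentiableOn ℂ Kt ((fun x : ℝ => (x : ℂ)) '' (X : Set ℝ))ᶜ ∧ (∀ w : ℂ, 0 < w.im → Kt w = a * K w) ∧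 (∀ w : ℂ, w.im ≠ 0 → Kt (starRingEnd ℂ w) = starRingEnd ℂ (Kt w)) ∧ (∀ t : ℝ, t ∉ X → (Kt t).im = 0 ∧ 0 ≤ (Kt t).re) ∧ ∀ S : Set ℝ, IsOpen S → (∀ x ∈ X, x ∉ S) → ν.restrict S = (MeasureTheory.volume.withDensity fun t : ℝ => ENNReal.ofReal (Kt t).re).restrict S := by
  intro K X a ν hK hloc
  classical
  -- the complexified corner set and its (open, symmetric) complement `U`
  set Xc : Set ℂ := (fun x : ℝ => (x : ℂ)) '' (X : Set ℝ) with hXc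
  set U : Set ℂ := Xcᶜ with hU
  have hUo : IsOpen U := (X.finite_toSet.image _).isClosed.isOpen_compl
  have hUsymm : ∀ z ∈ U, conj z ∈ U := by
    rintro z hz ⟨x, hx, hxz⟩
    refine hz ⟨x, hx, ?_⟩
    rw [← conj_conj z, ← hxz, conj_ofReal]
  have hU_real : ∀ t : ℝ, (t : ℂ) ∈ U ↔ t ∉ X := by
    intro t
    constructor
    · rintro h ht
      exact h ⟨t, ht, rfl⟩
    · rintro ht ⟨x, hx, hxt⟩
      rw [ofReal_inj] at hxt
      exact ht (hxt ▸ hx)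
  -- the local data
  choose! r hr hfar G hGd hGK hGpos hGν using hloc
  have hballU : ∀ t, t ∉ X → ball (t : ℂ) (r t) ⊆ U := by
    rintro t ht w hw ⟨x, hx, rfl⟩
    have h1 := hfar t ht x hx
    rw [mem_ball, dist_eq_norm, ← ofReal_sub, norm_real, Real.norm_eq_abs, abs_sub_comm] at hw
    linarith
  have hmemI : ∀ t, t ∉ X → ∀ s ∈ Ioo (t - r t / 2) (t + r t / 2),
      (s : ℂ) ∈ ball (t : ℂ) (r t / 2) := by
    intro t _ s hs
    rw [mem_ball, dist_eq_norm, ← ofReal_sub, norm_real, Real.norm_eq_abs, abs_lt]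
    constructor <;> linarith [hs.1, hs.2]
  -- `f = a K` and its boundary-value extension `F`
  set f : ℂ → ℂ := fun w => a * K w with hf
  set F : ℂ → ℂ := upperExt U f with hF
  have hFloc : ∀ t, t ∉ X → ∀ z ∈ ball (t : ℂ) (r t / 2), 0 ≤ z.im → F z = a * G t z := by
    intro t ht z hz hzim
    refine upperExt_eq_of_local hUo (hballU t ht) (G := fun w => a * G t w) ?_ ?_ hz hzim
    · exact (differentiableOn_const a).mul
        ((hGd t ht).mono (ball_subset_ball (by linarith [hr t ht])))
    · intro w hw
      show a * G t w = a * K w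
      rw [hGK t ht ⟨ball_subset_ball (by linarith [hr t ht]) hw.1, hw.2⟩]
  have hFup : ∀ z : ℂ, 0 < z.im → F z = a * K z := fun z hz => upperExt_of_im_pos hz
  have hfdiff : DifferentiableOn ℂ f {w : ℂ | 0 < w.im} := (differentiableOn_const a).mul hK
  -- continuity of `F` on `U ∩ {im ≥ 0}`
  have hFc : ContinuousOn F (U ∩ {z | 0 ≤ z.im}) := by
    rintro z ⟨hzU, hzim⟩
    have hzim' : 0 ≤ z.im := hzim
    rcases hzim'.lt_or_eq with hpos | h0
    · have hfc : ContinuousAt f z :=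
        hfdiff.continuousOn.continuousAt ((isOpen_lt continuous_const continuous_im).mem_nhds hpos)
      refine (hfc.congr ?_).continuousWithinAt
      filter_upwards [(isOpen_lt continuous_const continuous_im).mem_nhds hpos] with w hw
      exact (hFup w hw).symm
    · have hzr : z = ((z.re : ℝ) : ℂ) := Complex.ext rfl (by simp [← h0])
      rw [hzr] at hzU ⊢
      have ht : z.re ∉ X := (hU_real _).1 hzU
      have hmem : ((z.re : ℝ) : ℂ) ∈ ball ((z.re : ℝ) : ℂ) (r z.re / 2) :=
        mem_ball_self (by linarith [hr _ ht])
      have hGc : ContinuousAt (fun w => a * G z.re w) ((z.re : ℝ) : ℂ) :=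
        (continuousOn_const.mul (hGd _ ht).continuousOn).continuousAt
          (isOpen_ball.mem_nhds (mem_ball_self (hr _ ht)))
      have hev : F =ᶠ[𝓝[U ∩ {z | 0 ≤ z.im}] ((z.re : ℝ) : ℂ)] fun w => a * G z.re w := by
        filter_upwards [mem_nhdsWithin_of_mem_nhds (isOpen_ball.mem_nhds hmem),
          self_mem_nhdsWithin] with w hw hw'
        exact hFloc _ ht w hw hw'.2
      exact hGc.continuousWithinAt.congr_of_eventuallyEq hev (hFloc _ ht _ hmem (by simp))
  -- `F` is a non-negative real on `U ∩ ℝ`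
  have hFreal_t : ∀ t : ℝ, t ∉ X → (F t).im = 0 ∧ 0 ≤ (F t).re := by
    intro t ht
    rw [hFloc t ht _ (mem_ball_self (by linarith [hr t ht])) (by simp)]
    exact hGpos t ht t ⟨by linarith [hr t ht], by linarith [hr t ht]⟩
  have hFreal : ∀ z ∈ U, z.im = 0 → conj (F z) = F z := by
    intro z hzU hz0
    have hzr : z = ((z.re : ℝ) : ℂ) := Complex.ext rfl (by simp [hz0])
    rw [hzr] at hzU ⊢
    exact conj_eq_iff_im.2 (hFreal_t _ ((hU_real _).1 hzU)).1
  have hFd : DifferentiableOn ℂ F (U ∩ {z | 0 < z.im}) :=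
    (hfdiff.mono inter_subset_right).congr fun z hz => hFup z hz.2
  -- the reflection
  set Kt : ℂ → ℂ := schwarzReflection F with hKt
  have hKtd : DifferentiableOn ℂ Kt U :=
    differentiableOn_schwarzReflection hUo hUsymm hFc hFd hFreal
  have hKt_real : ∀ t : ℝ, Kt t = F t := fun t => schwarzReflection_ofReal t
  refine ⟨Kt, hKtd, fun w hw => ?_, fun w hw => ?_, fun t ht => ?_, fun S hS hSX => ?_⟩
  · rw [hKt, schwarzReflection_of_nonneg hw.le, hFup w hw]
  · rcases lt_or_gt_of_ne hw with hneg | hpos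
    · rw [hKt, schwarzReflection_of_neg hneg, conj_conj, schwarzReflection_of_nonneg]
      rw [conj_im]
      linarith
    · rw [hKt, schwarzReflection_of_neg (by rw [conj_im]; linarith), conj_conj,
        schwarzReflection_of_nonneg hpos.le]
  · rw [hKt_real]
    exact hFreal_t t ht
  · -- `ν = re K̃ dx` locally around each point of `S`
    have hloc2 : ∀ t ∈ S, ∃ ρ : ℝ, 0 < ρ ∧ Ioo (t - ρ) (t + ρ) ⊆ S ∧
        ν.restrict (Ioo (t - ρ) (t + ρ)) = (volume.withDensity fun s : ℝ =>
          ENNReal.ofReal (Kt s).re).restrict (Ioo (t - ρ) (t + ρ)) := by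
      intro t htS
      have ht : t ∉ X := fun h => hSX t h htS
      obtain ⟨ε, hε, hεS⟩ := Metric.isOpen_iff.1 hS t htS
      have hm1 := min_le_left ε (r t / 2)
      have hm2 := min_le_right ε (r t / 2)
      refine ⟨min ε (r t / 2), lt_min hε (by linarith [hr t ht]), fun s hs => hεS ?_, ?_⟩
      · rw [mem_ball, Real.dist_eq, abs_lt]
        constructor <;> linarith [hs.1, hs.2]
      · have hJ : Ioo (t - min ε (r t / 2)) (t + min ε (r t / 2)) ⊆ Ioo (t - r t / 2) (t + r t / 2) :=
          Ioo_subset_Ioo (by linarith) (by linarith)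
        have h1 : ν.restrict (Ioo (t - min ε (r t / 2)) (t + min ε (r t / 2))) =
            (volume.withDensity fun s : ℝ => ENNReal.ofReal (a * G t s).re).restrict
              (Ioo (t - min ε (r t / 2)) (t + min ε (r t / 2))) := by
          rw [← Measure.restrict_restrict_of_subset hJ, hGν t ht,
            Measure.restrict_restrict_of_subset hJ]
        rw [h1, restrict_withDensity measurableSet_Ioo, restrict_withDensity measurableSet_Ioo]
        refine withDensity_congr_ae ((ae_restrict_iff' measurableSet_Ioo).2
          (Eventually.of_forall fun s hs => ?_))
        show ENNReal.ofReal (a * G t s).re = ENNReal.ofReal (Kt s).re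
        rw [hKt_real, hFloc t ht _ (hmemI t ht s (hJ hs)) (by simp)]
    choose! ρ hρ hρS hρν using hloc2
    have hcover : ⋃ t : S, Ioo ((t : ℝ) - ρ t) (t + ρ t) = S := by
      refine subset_antisymm (iUnion_subset fun t => hρS t t.2) fun s hs => ?_
      exact mem_iUnion.2 ⟨⟨s, hs⟩, by linarith [hρ s hs], by linarith [hρ s hs]⟩
    obtain ⟨T, hTc, hT⟩ := TopologicalSpace.isOpen_iUnion_countable
      (fun t : S => Ioo ((t : ℝ) - ρ t) (t + ρ t)) fun _ => isOpen_Ioo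
    rw [hcover] at hT
    rw [← hT]
    exact (Measure.restrict_biUnion_congr hTc).2 fun t _ => hρν t t.2

end RealLine

end Summit.CriticalPhenomena.SAWScalingLimit.Theorems.PolygonParitySqueeze

end
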